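import Summits.HodgeConjecture.HodgeConjecture.Theorems.F0P6aPELInputsRows   -- ★ previous part of the same Lines workfile `F0_P6a_PELInputs` (size-lint split ×3)
import HarnessLib

/-!
# `F0P6aPELInputs` — ★ RE-HOME of `Lines/F0_P6a_PELInputs.lean`, PART 3 of 3 (size-lint split; cut at a declaration boundary).

See PART 1 `Theorems/F0P6aPELInputsSpread.lean` for the full re-home header and the original module docstring (verbatim there). Namespaces and sections KEPT
(re-opened below exactly as they stand at the cut, with their `open`∕`variable` lines replayed); code bytes = the workfile՚s, docstrings included; options preamble repeated from PART 1.
HC_CM is proved only modulo the 7 printed citations (2 remaining: hLiu418 = stmt-HodgeConjecture-24832, h413 = stmt-HodgeConjecture-24833) until rung 0 closes; a re-home is count-neutral. -/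

set_option autoImplicit false

noncomputable section

namespace Summit.HodgeConjecture.HodgeConjecture.Cruxes.HLiu418.F0P6aPELInputs
set_option linter.dupNamespace false  -- `Summit.HodgeConjecture.HodgeConjecture.…` BY DESIGN (D-0017)
open CategoryTheory CategoryTheory.Limits NumberField IsDedekindDomain MulAction
open scoped Matrix Polynomial Pointwise
open Literature.NumberTheory.GaloisRepresentations
open Literature.NumberTheory.Automorphic Literature.NumberTheory.Automorphic.UnitaryGroup
open Literature.AlgebraicGeometry.ShimuraVarieties.UnitaryCanonicalModel
open Literature.NumberTheory.Automorphic.Liu2021.AppendixC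
open Literature.AlgebraicGeometry.Motives (AlgPoints IntegralModel SchemeOver thickening thickeningGalAction thickeningLift)
open Literature.NumberTheory.DiophantineGeometry (geomResidueField specialFibreFunctor)
open Literature.AlgebraicGeometry.RelativeSpec (ActionOver)
open Literature.NumberTheory.EllipticCurves (genericFibre)
open AlgebraicGeometry (QuasiCompact QuasiSeparated LocallyOfFinitePresentation Flat IsSeparated)
open Summit.HodgeConjecture.HodgeConjecture.Cruxes.HLiu418.F0P6aModuliDatumDefs
open Summit.HodgeConjecture.HodgeConjecture.Cruxes.HLiu418.F0P6aRGDAssembly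
open Summit.HodgeConjecture.HodgeConjecture.Cruxes.HLiu418.F0P6aPELWitnessE (PELWitnessE IsCMTypeThrough)
open Summit.HodgeConjecture.HodgeConjecture.Cruxes.HLiu418.F0P6aIsomSchemeFiniteType (TupleIsoAt₂)
open Summit.HodgeConjecture.HodgeConjecture.Cruxes.HLiu418.F0P6aStubKOTT (KottAdaptedAt UnmixedAt kottwitzΩ_of_gen_iso conjugate_comp_eq
  mOf_comp_eq_of_unmixedAt)
open Summit.HodgeConjecture.HodgeConjecture.Cruxes.HLiu418.F0P6aPELWitnessE (mOf)
open Summit.HodgeConjecture.HodgeConjecture.Theorems.F0P6aKottwitzCountAtSplitPlace (exists_restrict ker_residue_restrict_structural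
  ker_residue_restrict_structural_comp_complexConj sum_filter_ker_residue_restrict_eq_one)
open Summit.HodgeConjecture.HodgeConjecture.Theorems.F0P6aKottwitzAtOmegaOfComplexPoints (exists_ringHom_comp_eq)


/-! ### §1 The letters BY VALUE -/

section DualsLetter

open AlgebraicGeometry MonoidalCategory CartesianMonoidalCategory IsLocalRing
open scoped MonObj
open Literature.AlgebraicGeometry.AbelianSchemes Literature.AlgebraicGeometry.Motives Literature.AlgebraicGeometry.Motives.AbelianVariety
  Literature.AlgebraicGeometry.Limits Literature.AlgebraicGeometry.Modules

/-- **LETTER `DualPairOfAmpleRigidified` — THE RE-TYPED SOCKET `stub_DUALS` (LEAD «M-55c» R-DUALS; content LA4-p05 (g0), tokens LA4-plan (g0) 02:23:07Z, VERBATIM):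
DUAL PAIR OF AN ABELIAN SCHEME CARRYING A RIGIDIFIED, RANK-ONE, FIBREWISE-AMPLE `L` WITH `K(L)` KILLED BY AN INVERTIBLE EXPONENT, OVER A NOETHERIAN AFFINE BASE** —
for every Noetherian ring `R`, every abelian scheme `A → Spec R`, every rank-one `L` on `A` rigidified along the unit section whose class on every geometric fibre
is the class of an AMPLE Cartier divisor, and every `n ∈ R^×` with `u ^ n = 1` for all `u ∈ K(L)(T)`, `A` has a dual pair (★ `AbelianSchemeOver.DualPair`).  Binders
COPIED token for token from ★ (K′) `AbelianSchemeOver.exists_kOfL_etale_of_isUnit` (so road (A)՚s closer discharges it by `exact`); strictly WEAKER than the printed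
letter P-2′ `dualAbelianSchemeExists` (which stays booked capital: non-projective abelian schemes exist, [FaltingsChai1990] I 1.9); TRUE in print in every characteristic
(Mumford `Â := A ⁄ K(L)`); in-house road (A) = ★ (K′) + ★ (Mb′) `MumfordQuotientConstructionAnyChar` + ★ `PicZeroOntoOfFiniteKTheta` modulo O1 «H¹-dimension, any
characteristic».  CHAIN CONSUMER (B-p18 (g39) step (4)): the STAGE scheme with `L := L^Δ(λ)` of the spread polarisation, `n := 2 · ∏ δᵢ`, affine charts of the
stage base glued by ★ `nonempty_dualPair_of_charts`.  NOT asserted. (print: MumfordAV1970, §13 Theorem (p. 125))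
(print: MumfordFogartyKirwan1994, Ch. 6 §1 Corollary 6.8 (p. 118) and §2 Prop. 6.13 (p. 123)) (print: GortzWedhorn2023, Cor. 27.212) -/
def DualPairOfAmpleRigidified : Prop :=
  ∀ (R : Type) [CommRing R] [IsNoetherianRing R] (A : AbelianSchemeOver (Spec (.of R)))
    (hA : Literature.AlgebraicGeometry.Morphisms.IsProjective A.X.hom) (L : A.left.Modules) (hL : HasRank L 1),
    CechPic.pullback A.unitSection (detClass (HasRank.isFiniteLocallyFree' hL)) = 1 →
    (∀ ⦃Ω : Type⦄ [Field Ω] [IsAlgClosed Ω] (s : Spec (.of Ω) ⟶ Spec (.of R)),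
      ∃ Θ : CartierDivisor (A.fibre s).toAbelianVariety.X.left, Θ.IsAmple ∧
        CechPic.pullback (X := (A.fibre s).toAbelianVariety.X.left) (pullback.fst A.X.hom s)
          (detClass (HasRank.isFiniteLocallyFree' hL)) = Θ.cechClass) →
    ∀ (n : ℕ), IsUnit ((n : ℕ) : R) →
      (∀ (T : Over (Spec (.of R))) (u : T ⟶ A.X), A.MemKOfL L u → u ^ n = 1) →
      Nonempty A.DualPair

end DualsLetter

/-- **LETTER `RecordPELSpreadCofinal`** — `RecordPELInputsCofinal` (spine ED. 2 :281) TOKEN FOR TOKEN with `∃ (_ : NumberField Fi)` added to GEN՚s block and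
`Nonempty (RGDInputsAt …)` ↦ `∃ T : PELSpreadAt …, ESepAt … T.E ∧ PELInj0LawAt … T ∧ PELHeckeLawAt … T ∧ PELTwistLawAt … T`: GEN՚s choices `Fᵢ Kc G φ 𝓜 S_M` once, and at every good split
`w ∉ S_M`, `Kc` hyperspecial at `w`, `hdisj`, and THE SPREAD OF THE E-WITNESS with its provenance and its ★-organ rows, TOGETHER WITH (n5) the E-side point
separation of the witness used and the isogeny laws of THAT spread (twist data, `inj₀` by the cofinite passage on the constructor՚s global family,
`heckeRoofΩ`, `coverΩ`).  NOT asserted (the type of `stub_SPREAD`՚s conclusion).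
(print: RapoportSmithlingZhang2020Diagonal, §4.1 Thm. 4.1 p. 17) (print: Kottwitz1992, §5 pp. 389–391) -/
def RecordPELSpreadCofinal : Prop :=
  ∀ (F : Type) [Field F] [NumberField F] [IsCMField F] [IsGalois ℚ F] (ι₁ : F →+* ℂ)
    (Jstar : Matrix (Fin 2) (Fin 2) F)
    (K₀ : C5.OpenCompactSubgroup ↥(finAdelic ↥(maximalRealSubfield F) F (IsCMField.complexConj F) 2 Jstar))
    (S : RecordSystemGS F Jstar ι₁ K₀) (hU7ₛ : S.HeckeTranslateDefinedOver)
    (hJ : (Jstar.map (IsCMField.complexConj F))ᵀ = Jstar) (hJu : IsUnit Jstar) (K : C5.SmallLevel K₀),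
    ∃ (Fi : Type) (_ : Field Fi) (_ : NumberField Fi) (_ : Algebra F Fi) (_ : FiniteDimensional F Fi) (_ : IsGalois F Fi)
      (Kc : C5.SmallLevel K₀) (_hKcK : Kc ≤ K) (_hn : ∀ k ∈ K.1.1, C5.HeckeLE k Kc Kc)
      (G : Type) (_ : Group G) (_ : Finite G) (φ : ↥K.1.1 →* G) (_hφ : Function.Surjective φ)
      (_hφker : φ.ker = (Kc.1.1 : Subgroup ↥(finAdelic ↥(maximalRealSubfield F) F (IsCMField.complexConj F) 2 Jstar)).subgroupOf K.1.1)
      (𝓜 : IntegralModel (𝓞 F) F ((thickening F Fi).obj (S.M.obj Kc)))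
      (_ : QuasiCompact 𝓜.total.hom) (_ : QuasiSeparated 𝓜.total.hom) (_ : LocallyOfFinitePresentation 𝓜.total.hom)
      (_ : Flat 𝓜.total.hom) (_ : IsSeparated 𝓜.total.hom)
      (S_M : Set (HeightOneSpectrum (𝓞 F))), S_M.Finite ∧
      ∀ w : HeightOneSpectrum (𝓞 F), w ∉ S_M → ∀ hw : (IsCMField.complexConj F) • w ≠ w,
        (UnitaryGroup.isUnit_placeForm Jstar hJu w).unit ∈ glInt 2 (w.adicCompletion F) →
          UnitaryGroup.IsHyperspecialAt ↥(maximalRealSubfield F) F (IsCMField.complexConj F) 2 Jstar K.1.1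
            (w.under (𝓞 ↥(maximalRealSubfield F))) →
          UnitaryGroup.IsHyperspecialAt ↥(maximalRealSubfield F) F (IsCMField.complexConj F) 2 Jstar Kc.1.1
              (w.under (𝓞 ↥(maximalRealSubfield F))) ∧
          ∀ (h𝓨 : (𝓜.localise w).IsSmoothProper 1)
            (θ : ActionOver (𝓜.localise w).total.hom ((Fi ≃ₐ[F] Fi) × G))
            (_hθ : ∀ γ : Fi ≃ₐ[F] Fi,
               (genericFibre (HeightOneSpectrum.valuationSubringAtPrime F w) F).map
                     (Over.isoMk (θ.aut (γ, 1)) (θ.aut_comp (γ, 1))).hom ≫ (𝓜.localise w).genericIso'.hom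
                 = (𝓜.localise w).genericIso'.hom ≫
                     (Over.isoMk ((thickeningGalAction (L := Fi) (S.M.obj Kc)).aut γ)
                       ((thickeningGalAction (L := Fi) (S.M.obj Kc)).aut_comp γ)).hom)
            (e : Fi →ₐ[F] AlgebraicClosure (w.adicCompletion F)),
            haveI : AlgebraicGeometry.IsProper (𝓜.localise w).total.hom := h𝓨.2
            (∀ (β : Fi ≃ₐ[F] Fi) (P Q : AlgPoints (S.M.obj Kc) (AlgebraicClosure (w.adicCompletion F))),
                (𝓜.localise w).geomReductionMap (thickeningLift e (S.M.obj Kc) P) =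
                  AlgPoints.map ((specialFibreFunctor w).map (Over.isoMk (θ.aut (β, 1)) (θ.aut_comp (β, 1))).hom :
                      (𝓜.localise w).reductionAt ⟶ (𝓜.localise w).reductionAt)
                    ((𝓜.localise w).geomReductionMap (thickeningLift e (S.M.obj Kc) Q)) → β = 1) ∧
              ∃ T : PELSpreadAt F ι₁ Jstar K₀ S hU7ₛ hJ hJu Fi Kc G 𝓜 w hw h𝓨 θ e,
                ESepAt S Kc w T.E ∧ PELInj0LawAt F ι₁ Jstar K₀ S hU7ₛ hJ hJu Fi Kc G 𝓜 w hw h𝓨 θ e T ∧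
                  PELHeckeLawAt F ι₁ Jstar K₀ S hU7ₛ hJ hJu Fi Kc G 𝓜 w hw h𝓨 θ e T ∧ PELTwistLawAt F ι₁ Jstar K₀ S hU7ₛ hJ hJu Fi Kc G 𝓜 w hw h𝓨 θ e T

/-- **LETTER `RecordGenericInjectivity`** — (L1) AS TRANSPORT, TRUE for EVERY spread-with-provenance `T` (n5-proof): given E-side point separation
`ESepAt … T.E` of the witness `T` carries, two record points read on the SAME sheet `e′` whose generic `T`-tuples at `genPt … e′ yᵢ = ℓ_{e′} yᵢ ≫ genIncl`
(`rfl`) are isomorphic are EQUAL: base-change composition for the five structures + `T.gen_iso e′ y₁`, `T.gen_iso e′ y₂` (★ `TupleIsoAt₂`, symmetric and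
transitive with ★ `tupleIsoAt`) + `ESepAt`.  No exceptional set.  Zero new mathematics, honest plumbing (size L).  NOT asserted.
(print: MumfordFogartyKirwan1994, Ch. 7 §2 Def. 7.2 p. 129; §3 Thm. 7.9 p. 139) (print: RapoportSmithlingZhang2020Diagonal, §4.1 Thm. 4.1 p. 17) -/
def RecordGenericInjectivity : Prop :=
  ∀ (F : Type) [Field F] [NumberField F] [IsCMField F] [IsGalois ℚ F] (ι₁ : F →+* ℂ)
    (Jstar : Matrix (Fin 2) (Fin 2) F)
    (K₀ : C5.OpenCompactSubgroup ↥(finAdelic ↥(maximalRealSubfield F) F (IsCMField.complexConj F) 2 Jstar))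
    (S : RecordSystemGS F Jstar ι₁ K₀) (hU7ₛ : S.HeckeTranslateDefinedOver)
    (hJ : (Jstar.map (IsCMField.complexConj F))ᵀ = Jstar) (hJu : IsUnit Jstar)
    (Fi : Type) [Field Fi] [NumberField Fi] [Algebra F Fi] [FiniteDimensional F Fi] [IsGalois F Fi]
    (Kc : C5.SmallLevel K₀) (G : Type) [Group G] [Finite G]
    (𝓜 : IntegralModel (𝓞 F) F ((thickening F Fi).obj (S.M.obj Kc)))
    (w : HeightOneSpectrum (𝓞 F)) (hw : (IsCMField.complexConj F) • w ≠ w) (h𝓨 : (𝓜.localise w).IsSmoothProper 1)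
    (θ : ActionOver (𝓜.localise w).total.hom ((Fi ≃ₐ[F] Fi) × G))
    (_hθ : ∀ γ : Fi ≃ₐ[F] Fi,
       (genericFibre (HeightOneSpectrum.valuationSubringAtPrime F w) F).map
             (Over.isoMk (θ.aut (γ, 1)) (θ.aut_comp (γ, 1))).hom ≫ (𝓜.localise w).genericIso'.hom
         = (𝓜.localise w).genericIso'.hom ≫
             (Over.isoMk ((thickeningGalAction (L := Fi) (S.M.obj Kc)).aut γ)
               ((thickeningGalAction (L := Fi) (S.M.obj Kc)).aut_comp γ)).hom)
    (e : Fi →ₐ[F] AlgebraicClosure (w.adicCompletion F))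
    (_hunit : (UnitaryGroup.isUnit_placeForm Jstar hJu w).unit ∈ glInt 2 (w.adicCompletion F))
    (_hKc : UnitaryGroup.IsHyperspecialAt ↥(maximalRealSubfield F) F (IsCMField.complexConj F) 2 Jstar Kc.1.1
      (w.under (𝓞 ↥(maximalRealSubfield F))))
    (T : PELSpreadAt F ι₁ Jstar K₀ S hU7ₛ hJ hJu Fi Kc G 𝓜 w hw h𝓨 θ e) (_hsep : ESepAt S Kc w T.E)
      (e' : Fi →ₐ[F] AlgebraicClosure (w.adicCompletion F)) (y₁ y₂ : AlgPoints (S.M.obj Kc) (AlgebraicClosure (w.adicCompletion F))),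
        tupleIsoAt (genPt S Kc 𝓜 w e' y₁) (genPt S Kc 𝓜 w e' y₂) T.univ T.act T.dual T.pol T.lvl → y₁ = y₂

/-- **LETTER `RecordKottwitzSheets`** — (K-Ω) AS A LAW-STUB BY NAME (F0P6-ref1 (g3) o-17, LEAD «M-47 addendum» CHOICE (S); M-35 roster): UNIVERSAL over
(context, GEN՚s choices, a finite exceptional set, a good split `w`, a spread with provenance `T`): the Kottwitz rows `PELKottLawAt … T` — a signature `m`
with the COUNT `∑_{τ inducing c•w} m τ = 1` (arithmetic of `(F, w, T.Φ)`: ★ p847313 `Theorems/F0P6aKottwitzCountAtSplitPlace`) and KOTTWITZ AT EVERY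
`Ω`-POINT OF EVERY SHEET for `(T.univ, T.act)` (`T.E.kottwitz` at complex points ⇒ at `Ω̄_w`-points: ★ p847344 `Theorems/F0P6aKottwitzAtOmegaOfComplexPoints`,
transported along `T.gen_iso`).  TRUE for every by-value `T` (it survives the n5 junk models: junk fibres are genuine PEL fibres); the FIRST socket that can
close visibly on landed ★.  NOT asserted. (print: Kottwitz1992, §5 p. 390) (print: RapoportSmithlingZhang2020Diagonal, §4.1 (4.6) p. 16; §4.1 Thm. 4.1 p. 17) -/
def RecordKottwitzSheets : Prop :=
  ∀ (F : Type) [Field F] [NumberField F] [IsCMField F] [IsGalois ℚ F] (ι₁ : F →+* ℂ)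
    (Jstar : Matrix (Fin 2) (Fin 2) F)
    (K₀ : C5.OpenCompactSubgroup ↥(finAdelic ↥(maximalRealSubfield F) F (IsCMField.complexConj F) 2 Jstar))
    (S : RecordSystemGS F Jstar ι₁ K₀) (hU7ₛ : S.HeckeTranslateDefinedOver)
    (hJ : (Jstar.map (IsCMField.complexConj F))ᵀ = Jstar) (hJu : IsUnit Jstar)
    (Fi : Type) [Field Fi] [NumberField Fi] [Algebra F Fi] [FiniteDimensional F Fi] [IsGalois F Fi]
    (Kc : C5.SmallLevel K₀) (G : Type) [Group G] [Finite G]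
    (𝓜 : IntegralModel (𝓞 F) F ((thickening F Fi).obj (S.M.obj Kc))),
    ∃ Sx : Set (HeightOneSpectrum (𝓞 F)), Sx.Finite ∧
    ∀ (w : HeightOneSpectrum (𝓞 F)) (_hSx : w ∉ Sx) (hw : (IsCMField.complexConj F) • w ≠ w) (h𝓨 : (𝓜.localise w).IsSmoothProper 1)
    (θ : ActionOver (𝓜.localise w).total.hom ((Fi ≃ₐ[F] Fi) × G))
    (_hθ : ∀ γ : Fi ≃ₐ[F] Fi,
       (genericFibre (HeightOneSpectrum.valuationSubringAtPrime F w) F).map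
             (Over.isoMk (θ.aut (γ, 1)) (θ.aut_comp (γ, 1))).hom ≫ (𝓜.localise w).genericIso'.hom
         = (𝓜.localise w).genericIso'.hom ≫
             (Over.isoMk ((thickeningGalAction (L := Fi) (S.M.obj Kc)).aut γ)
               ((thickeningGalAction (L := Fi) (S.M.obj Kc)).aut_comp γ)).hom)
    (e : Fi →ₐ[F] AlgebraicClosure (w.adicCompletion F))
    (_hunit : (UnitaryGroup.isUnit_placeForm Jstar hJu w).unit ∈ glInt 2 (w.adicCompletion F))
    (_hKc : UnitaryGroup.IsHyperspecialAt ↥(maximalRealSubfield F) F (IsCMField.complexConj F) 2 Jstar Kc.1.1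
      (w.under (𝓞 ↥(maximalRealSubfield F))))
    (T : PELSpreadAt F ι₁ Jstar K₀ S hU7ₛ hJ hJu Fi Kc G 𝓜 w hw h𝓨 θ e),
      PELKottLawAt F ι₁ Jstar K₀ S hU7ₛ hJ hJu Fi Kc G 𝓜 w hw h𝓨 θ e T

/-! ### §2 The registered letters (ED. 4: `stub_DUALS` PAID by ★; `stub_KOTT` ∕ `stub_INJ` paid in-line since v6c; `stub_SPREAD` RETIRED — paid downstream) -/

/-- **`stub_DUALS` — THE RE-TYPED DUALS SOCKET `DualPairOfAmpleRigidified`** (v6g, LEAD «M-55c» R-DUALS: the road-(A) shape actually consumed by the SPREAD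
chain at its polarized — hence projective — stage scheme; pay-down road (A) = ★ (K′) `exists_kOfL_etale_of_isUnit` + ★ (Mb′) Mumford quotient + ★ PIC0-ONTO modulo O1
«H¹-dimension any characteristic» (B-p04 (g41) ∕ LA4-p05 (g0) lineage); the printed letter P-2′ `dualAbelianSchemeExists` stays booked capital).
[cite: MumfordAV1970, §13 Theorem (p. 125)] [cite: MumfordFogartyKirwan1994, Ch. 6 §1 Corollary 6.8 (p. 118) and §2 Prop. 6.13 (p. 123)] [cite: GortzWedhorn2023, Cor. 27.212] -/
theorem stub_DUALS : DualPairOfAmpleRigidified :=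
  -- ED. 4: PAID BY NAME — the ★ payer MAIN ED. 9 passes to `pel_of_inputs` (statement above unchanged; TRIO expected)
  Literature.AlgebraicGeometry.AbelianSchemes.MumfordDual.dualPairOfAmpleRigidified

/-! **`stub_SPREAD` RETIRED (ED. 4 «dead letters out», LEAD «M-95» (2)).**  The registered stub `stub_SPREAD : DualPairOfAmpleRigidified → RecordPELSpreadCofinal`
(ED. 1–3; docstring and citations of record in git, ED. 3 41fbe5d2c8ab8aa9 :755–770) has been BY-PASSED since MAIN ED. 9: its mass is paid DOWNSTREAM, by name, as
`F0P6aPELSpread.spread_of_parts F0P6aStubGSPREAD.gspread_of_line F0P6aPELSpread.stub_INJ0 F0P6aStubGEN.elaws_of_line` (modules importing THIS file — the payment cannot be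
pulled up here without an import cycle).  Books (LEAD 10:55:30Z): CLOSED-DERIVED modulo `F0P6aStubESHEET.hole_SHEET_global` (= the `stub_SHEET` socket #29). -/

/-- **`stub_KOTT` PAID IN-LINE (v6c∕v6g, LEAD «M-51»∕«M-57c»; ED. 2: THROUGH THE §0c HOIST `kottRows_explicit`) — THE KOTTWITZ ROWS ON EVERY SHEET
`RecordKottwitzSheets`** ((K-Ω), o-17 (S)), with EMPTY exceptional set, on the EXPLICIT frame signature `m₀ := mOf ι₁ T.Φ (σ₀ ∘ ·)` for a complex embedding `σ₀` of
`F̄_w` over `ι₁` (★ p847344 `exists_ringHom_comp_eq`) and the restrictions `τR` (★ p847313 `exists_restrict`): `⟨m₀, τR, hτR, kottRows_explicit T σ₀ hσ₀ τR hτR⟩` — the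
count under (K-prov-2) `T.hΦw`, `KottwitzΩ` by KOTT leaf `kottwitzΩ_of_gen_iso` ((K-prov-1) `T.hτE`), the signature rows `m_pair`∕`m_banal` by §0b (`T.hΦ`), `m_unmixed` by
KOTT ED. 2 `mOf_comp_eq_of_unmixedAt` ((K-prov-3) `T.hΦu`), all inside §0c.  Statement BYTE-IDENTICAL to ED. 1. [cite: Kottwitz1992, §5 p. 390]
[cite: RapoportSmithlingZhang2020Diagonal, §4.1 (4.6) p. 16 and p. 17; §3.2 (3.8) p. 11] -/
theorem stub_KOTT : RecordKottwitzSheets := by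
  intro F _ _ _ _ ι₁ Jstar K₀ S hU7ₛ hJ hJu Fi _ _ _ _ _ Kc G _ _ 𝓜
  refine ⟨∅, Set.finite_empty, ?_⟩
  intro w _ hw h𝓨 θ _ e _ _ T
  obtain ⟨σ₀, hσ₀'⟩ := exists_ringHom_comp_eq F w F
    ((algebraMap (w.adicCompletion F) (AlgebraicClosure (w.adicCompletion F))).comp (algebraMap F (w.adicCompletion F))) ι₁
  have hσ₀ : σ₀.comp (algebraMap F (AlgebraicClosure (w.adicCompletion F))) = ι₁ := by
    rw [IsScalarTower.algebraMap_eq F (w.adicCompletion F) (AlgebraicClosure (w.adicCompletion F))]; exact hσ₀'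
  obtain ⟨τR, hτR⟩ := exists_restrict w
  exact ⟨fun τ => mOf ι₁ T.Φ (σ₀.comp τ), τR, hτR, kottRows_explicit T σ₀ hσ₀ τR hτR⟩

/-- **`stub_INJ` PAID IN-LINE (v6c; LEAD «M-48»∕«M-51») — GENERIC FINE-MODULI INJECTIVITY PER SHEET AS TRANSPORT `RecordGenericInjectivity`** ((L1)):
`genPt S Kc 𝓜 w e′ y = ℓ_{e′} y ≫ genIncl S Kc 𝓜 w` definitionally, so an isomorphism of the `T`-tuples at the two generic points is a five-clause relation between
the SINGLE pull-backs along `ℓᵢ ≫ ι_η`; ★ BRICK (T) `tupleRel_baseChangeCompGrpIso_inv ∕ _hom` moves it to the ITERATED pull-backs `(T.univ ×_𝓨 X_{Fᵢ}) ×_{X_{Fᵢ}} ℓᵢ`,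
where `T.gen_iso e′ y₁` — INVERTED by ★ p847478 `exists_tupleRel_id_symm` at the reduced connected Noetherian point `Spec Ω̄_w` (unit hypotheses from
`Polarization.nonempty_unitHatSlice_iso`) — and `T.gen_iso e′ y₂` flank it; ★ `tupleRel_comp_id_id` composes the five relations into an isomorphism of the
E-tuples at `ℓ y₁`, `ℓ y₂`, and `ESepAt` separates.  Zero new mathematics. [cite: MumfordFogartyKirwan1994, Ch. 7 §2 Def. 7.2 p. 129; §3 Theorem 7.9 (p. 139)]
[cite: RapoportSmithlingZhang2020Diagonal, §4.1 Thm. 4.1 p. 17] -/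
theorem stub_INJ : RecordGenericInjectivity := by
  intro F _ _ _ _ ι₁ Jstar K₀ S hU7ₛ hJ hJu Fi _ _ _ _ _ Kc G _ _ 𝓜 w hw h𝓨 θ _hθ e _hunit _hKc T hsep e' y₁ y₂ h
  -- notation: the sheet points and the generic inclusion
  set gI := genIncl S Kc 𝓜 w
  set ℓ₁ := (thickeningLift e' (S.M.obj Kc) y₁).left
  set ℓ₂ := (thickeningLift e' (S.M.obj Kc) y₂).left
  -- the hypothesis, unfolded: five clauses between the SINGLE pull-backs along `ℓᵢ ≫ gI`
  obtain ⟨G, Ĝ, hrel⟩ := h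
  change _ ∧ _ ∧ _ ∧ _ ∧ _ at hrel
  -- the geometric point is reduced, locally Noetherian, connected
  haveI : PreconnectedSpace ↥(AlgebraicGeometry.Spec (CommRingCat.of (AlgebraicClosure (w.adicCompletion F)))) :=
    ⟨(PreirreducibleSpace.isPreirreducible_univ
      (X := ↥(AlgebraicGeometry.Spec (CommRingCat.of (AlgebraicClosure (w.adicCompletion F)))))).isPreconnected⟩
  haveI : AlgebraicGeometry.IsReduced
      (Literature.AlgebraicGeometry.Motives.specOver F (AlgebraicClosure (w.adicCompletion F))).left :=
    inferInstanceAs (AlgebraicGeometry.IsReduced (AlgebraicGeometry.Spec (CommRingCat.of (AlgebraicClosure (w.adicCompletion F)))))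
  haveI : AlgebraicGeometry.IsLocallyNoetherian
      (Literature.AlgebraicGeometry.Motives.specOver F (AlgebraicClosure (w.adicCompletion F))).left :=
    inferInstanceAs
      (AlgebraicGeometry.IsLocallyNoetherian (AlgebraicGeometry.Spec (CommRingCat.of (AlgebraicClosure (w.adicCompletion F)))))
  haveI : PreconnectedSpace
      ↥(Literature.AlgebraicGeometry.Motives.specOver F (AlgebraicClosure (w.adicCompletion F))).left :=
    inferInstanceAs (PreconnectedSpace ↥(AlgebraicGeometry.Spec (CommRingCat.of (AlgebraicClosure (w.adicCompletion F)))))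
  -- comparison relations (iterated ↔ single) for the `T`-tuple at `ℓ₁`, `ℓ₂`
  have c₁ := Literature.AlgebraicGeometry.AbelianSchemes.AbelianSchemeOver.tupleRel_baseChangeCompGrpIso_inv T.univ T.act T.dual T.pol T.lvl gI ℓ₁
  have c₂ := Literature.AlgebraicGeometry.AbelianSchemes.AbelianSchemeOver.tupleRel_baseChangeCompGrpIso_hom T.univ T.act T.dual T.pol T.lvl gI ℓ₂
  -- `gen_iso` at `y₁` (inverted) and at `y₂`
  obtain ⟨G₁, Ĝ₁, g₁⟩ := T.gen_iso e' y₁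
  obtain ⟨G₂, Ĝ₂, g₂⟩ := T.gen_iso e' y₂
  haveI := ((T.pol.baseChange gI).baseChange ℓ₁).isMonHom
  obtain ⟨G₁', Ĝ₁', g₁'⟩ := Literature.AlgebraicGeometry.AbelianSchemes.AbelianSchemeOver.exists_tupleRel_id_symm
    (((T.dual.baseChange gI).baseChange ℓ₁)) (T.E.P.D.baseChange ℓ₁)
    ((T.pol.baseChange gI).baseChange ℓ₁).lam (T.E.P.pol.baseChange ℓ₁).lam
    ((T.pol.baseChange gI).baseChange ℓ₁).nonempty_unitHatSlice_iso (T.E.P.pol.baseChange ℓ₁).nonempty_unitHatSlice_iso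
    ((T.lvl.baseChange gI).baseChange ℓ₁) (T.E.P.level.baseChange ℓ₁)
    (fun a => Literature.AlgebraicGeometry.AbelianSchemes.AbelianSchemeOver.baseChangeHom ((T.act.baseChange gI).i a) ℓ₁)
    (fun a => Literature.AlgebraicGeometry.AbelianSchemes.AbelianSchemeOver.baseChangeHom (T.E.ρ.i a) ℓ₁) g₁
  -- compose: E@ℓ₁ → U₁ → V₁ → V₂ → U₂ → E@ℓ₂
  have r := Literature.AlgebraicGeometry.AbelianSchemes.AbelianSchemeOver.tupleRel_comp_id_id
    (Literature.AlgebraicGeometry.AbelianSchemes.AbelianSchemeOver.tupleRel_comp_id_id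
      (Literature.AlgebraicGeometry.AbelianSchemes.AbelianSchemeOver.tupleRel_comp_id_id
        (Literature.AlgebraicGeometry.AbelianSchemes.AbelianSchemeOver.tupleRel_comp_id_id g₁' c₁) hrel) c₂) g₂
  exact hsep e' y₁ y₂ ⟨_, _, r⟩


/-! ### §3 HEAD: the socket letter from the parts (v6f: PARAMETRIC in the two open stubs, desk heir (g4) 01:47:49Z ∕ W2′ precedent `rgd_of_inputs`) -/

/-- **PARAMETRIC HEAD `pel_of_inputs (hSPREAD) (hDUALS) : RecordPELInputsCofinal`** (v6f; SORRY-FREE, no open stub inside — `stub_KOTT`∕`stub_INJ` are PROVED theorems) —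
the letter from ANY proof of the SPREAD mass `DualPairOfAmpleRigidified → RecordPELSpreadCofinal` and ANY proof of the DUALS letter `DualPairOfAmpleRigidified` (v6g):
GEN՚s choices, the spread with provenance, its E-side separation and its three folded laws from `hSPREAD hDUALS`; the Kottwitz rows from `stub_KOTT` with its
finite exceptional set unioned into `S_M`; (L1) `injΩ` by `stub_INJ` (transport); ZIP by `inputsOfParts`.  ED. 3 ((H1), LEAD «M-71»): `S_M` is ALSO enlarged by the finite
set `{v | ∃ p prime, 𝔭_v² ∣ (p)}` (★ `finite_setOf_sq_dvd_span_natCast`), off which the zip՚s new row `hunr` is `fun hsq => hwD ⟨T.pChar, T.hpChar.1, hsq⟩`.  A closer leaf ABOVE this line (P-line ED. 2 «GLOBAL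
SPREAD», head `spread_of_line`) is consumed by main ED. 8 as `rgd_of_inputs (pel_of_inputs spread_of_line stub_DUALS) datum_of_line`; until then `pel_of_line`
below instantiates it at the two registered stubs. [cite: RapoportSmithlingZhang2020Diagonal, §4.1 Thm. 4.1 p. 17] -/
theorem pel_of_inputs (hSPREAD : DualPairOfAmpleRigidified → RecordPELSpreadCofinal) (hDUALS : DualPairOfAmpleRigidified) :
    RecordPELInputsCofinal := by
  intro F _ _ _ _ ι₁ Jstar K₀ S hU7ₛ hJ hJu K
  -- GEN՚s 22 choices PEELED by `Exists.elim`, never `obtain`∕`cases` against the letter-sized goal (B-p18 (g38) 2026-09-02T00:28Z profile: one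
  -- 24-pattern `obtain` here ≈ 8.7 s ≈ 10⁶ heartbeats; the `Exists.elim` chain never touches the goal); then projections and `Exists.elim` only.
  refine (hSPREAD hDUALS F ι₁ Jstar K₀ S hU7ₛ hJ hJu K).elim fun Fi h => h.elim fun iF h => h.elim fun iNF h =>
    h.elim fun iA h => h.elim fun iFD h => h.elim fun iG h => h.elim fun Kc h => h.elim fun hKcK h => h.elim fun hn h =>
    h.elim fun G h => h.elim fun iGr h => h.elim fun iFin h => h.elim fun φ h => h.elim fun hφ h => h.elim fun hφker h =>
    h.elim fun 𝓜 h => h.elim fun i1 h => h.elim fun i2 h => h.elim fun i3 h => h.elim fun i4 h => h.elim fun i5 h =>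
    h.elim fun S_M h => ?_
  -- the ONE law-stub with its own finite exceptional set (o-17 (S)): `Exists.choose`, unioned into `S_M`
  have hK₀ := stub_KOTT F ι₁ Jstar K₀ S hU7ₛ hJ hJu Fi Kc G 𝓜
  -- ED. 3 ((H1), LEAD «M-71»): the THIRD finite exceptional set — the places where some `(p)` is not square-free (★ p849762; ⊆ the prime factors of `𝔇_{F∕ℚ}`)
  refine ⟨Fi, iF, iA, iFD, iG, Kc, hKcK, hn, G, iGr, iFin, φ, hφ, hφker, 𝓜, i1, i2, i3, i4, i5,
    S_M ∪ hK₀.choose ∪ {v : HeightOneSpectrum (𝓞 F) | ∃ p : ℕ, p.Prime ∧ v.asIdeal ^ 2 ∣ Ideal.span {(p : 𝓞 F)}},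
    (h.1.union hK₀.choose_spec.1).union Literature.NumberTheory.NumberFields.finite_setOf_sq_dvd_span_natCast, ?_⟩
  intro w hwS hw hunit hK
  have hw₀ : w ∉ S_M := fun h' => hwS (Or.inl (Or.inl h'))
  have hwK : w ∉ hK₀.choose := fun h' => hwS (Or.inl (Or.inr h'))
  have hwD : ¬ ∃ p : ℕ, p.Prime ∧ w.asIdeal ^ 2 ∣ Ideal.span {(p : 𝓞 F)} := fun h' => hwS (Or.inr h')
  have hKw := h.2 w hw₀ hw hunit hK
  refine ⟨hKw.1, fun h𝓨 θ hθ e => ?_⟩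
  have hin := hKw.2 h𝓨 θ hθ e
  refine hin.2.elim fun T hT => ?_
  exact ⟨hin.1, ⟨inputsOfParts F ι₁ Jstar K₀ S hU7ₛ hJ hJu Fi Kc G 𝓜 w hw h𝓨 θ e T hT.2.1 hT.2.2.1 hT.2.2.2
    (hK₀.choose_spec.2 w hwK hw h𝓨 θ hθ e hunit hKw.1 T)
    (stub_INJ F ι₁ Jstar K₀ S hU7ₛ hJ hJu Fi Kc G 𝓜 w hw h𝓨 θ hθ e hunit hKw.1 T hT.1)
    (fun hsq => hwD ⟨T.pChar, T.hpChar.1, hsq⟩)⟩⟩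

/-! **HEAD of the line = `pel_of_inputs` (ED. 4).**  MAIN ED. 9 reads it as `F0P6aPELInputs.pel_of_inputs (F0P6aPELSpread.spread_of_parts F0P6aStubGSPREAD.gspread_of_line
F0P6aPELSpread.stub_INJ0 F0P6aStubGEN.elaws_of_line) Literature.AlgebraicGeometry.AbelianSchemes.MumfordDual.dualPairOfAmpleRigidified` inside `stub_RGD`; the ED. 1–3
instantiation `pel_of_line := pel_of_inputs stub_SPREAD stub_DUALS` is RETIRED with `stub_SPREAD` (no by-name consumer in the tree). -/

end Summit.HodgeConjecture.HodgeConjecture.Cruxes.HLiu418.F0P6aPELInputs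

end
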